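import Mathlib
import HarnessLib
import Summits.AtomisticToContinuum.FouriersLaw.Theses.JunctionLocality
import Summits.AtomisticToContinuum.FouriersLaw.Theorems.JunctionLocalityConductanceLowerBoundStubFisherSquare
import Summits.AtomisticToContinuum.FouriersLaw.Theorems.JunctionLocalitySuperadditiveResistanceKuboGauss
import Summits.AtomisticToContinuum.FouriersLaw.Theorems.JunctionLocalitySuperadditiveResistancePlainAdjoint
import Summits.AtomisticToContinuum.FouriersLaw.Theorems.JunctionLocalitySuperadditiveResistanceKuboReversal
import Literature.MathematicalPhysics.KineticTheory.LangevinChainSDE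

/-!
# Certificate pairing identities for the transmission-gradient floor, I: pairing with the energy
(crux stmt-AtomisticToContinuum-11749, line `ForecastSensitivitySketch`)

Helper file (`--supports stmt-AtomisticToContinuum-11749`, lead c5).  THIS FILE proves `certificate_pairing_hamiltonian`;
the companion files `…CertificatePairingSource` and `…CertificateObstruction` prove the other items of the overview below.

Fix `pinnedChain ω₂ lam β γ` (`ω₂ > 0`, `lam, β ≥ 0`), `T > 0`, `L ≥ 2`, `μ_T = gibbsMeasure L T`, the two contact
momenta `p_0, p_{L−1}`, `S_B = bathOp L (bathWeight L) T` (the two Ornstein–Uhlenbeck thermostats) and `X_H = liouvilleOp`.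
The left forward field `g` of the crux's floor solves `X_H g + γ S_B g = −(p_0² − T)`; the floor is the `N`-uniform
bound `(L−1)‖∂_{p_{L−1}} g‖² ≥ c`.  By the inf-side (Dirichlet/Thomson) variational principle for the non-reversible
generator, `‖∂_{p_0} g‖² + ‖∂_{p_{L−1}} g‖²` is the MINIMUM of the contact Dirichlet cost
`Σ_{b ∈ {0, L−1}} (‖∂_{p_b} φ‖² + ‖∂_{p_b} χ‖²)` over ADMISSIBLE PAIRS `(φ, χ)`:

  `γ · S_B φ + X_H χ = −(p_0² − T)` pointwise

(the pair `(g, g)` is admissible; so is the trivial pair `((p_0² − T)/(2γ), 0)`, of cost `T/γ²`).  The three files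
prove the two EXACT PAIRING IDENTITIES every admissible pair satisfies, and their consequences:

* `certificate_pairing_hamiltonian` — pairing the constraint with `H`:
  `γ (⟨p_0, ∂_{p_0} φ⟩ + ⟨p_{L−1}, ∂_{p_{L−1}} φ⟩) = T`;
* `certificate_pairing_source` — pairing the constraint with the source `p_0² − T`:
  `γ T ⟨p_0, ∂_{p_0} φ⟩ − ⟨χ, p_0 ∂_{q_0} H⟩ = T²`;
* `certificate_loading_reciprocity` — subtracting: `γ T ⟨p_{L−1}, ∂_{p_{L−1}} φ⟩ = −⟨χ, p_0 ∂_{q_0}H⟩`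
  (the far-contact dissipative loading of `φ` equals the near-contact kinetic-production loading of `χ`);
* `certificate_cost_ge_half` — every admissible pair has `‖∂_{p_0} φ‖² + ‖∂_{p_{L−1}} φ‖² ≥ T/(2γ²)`
  (the certificate form of the landed ceiling `G_L ≤ γ/2`);
* the TWO-ENDS OBSTRUCTION: `certificate_noGain_of_farFree` — if `∂_{p_{L−1}} φ ≡ 0` then `‖∂_{p_0} φ‖² ≥ T/γ²`;
  `certificate_noGain_of_reversalEven` — if `χ` is even under momentum reversal then `‖∂_{p_0} φ‖² ≥ T/γ²`.
  In either case the pair costs at least the trivial pair: a certificate improving on `G_L ≥ 0` must load the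
  far contact through `φ` AND carry a reversal-odd `χ` correlated with `p_0 ∂_{q_0}H` — it is a cross-chain
  transport object (lead c3's M3 / strategist S4 "admissibility wall", now kernel-checked).

All inputs are landed: the energy-cutoff toolkit (`Kubo.chi`, `integral_chi_mul_bathOp`,
`integral_chi_liouville_antisymm`, `tendsto_integral_chi_mul`, `tendsto_integral_partialP_chi_mul`), the Gaussian
moments (`integral_kinetic_mul_hamiltonian_mul_gibbsDensity`, `gauss_ibp`), `X_H H = 0`, reversal invariance of
`μ_T`.  No new definitions, no named facts, no sorry.  References: Bernardin–Olla 2011 §6 (variational formula);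
Komorowski–Landim–Olla 2012 §4 (inf/sup principles for non-reversible resolvents); folklore.
-/

noncomputable section

open MeasureTheory Filter Topology
open scoped ContDiff
open Literature.MathematicalPhysics.KineticTheory.HeatConduction
open Summit.AtomisticToContinuum.FouriersLaw.Theorems.SuperadditiveResistance.DeviceLiouville
  (kin kin_eq_sq continuous_kin liouvilleOp bathOp continuous_liouvilleOp continuous_bathOp
    pinnedChain_sq_le_two_mul_hamiltonian)
open Summit.AtomisticToContinuum.FouriersLaw.Theorems.SuperadditiveResistance.Kubo
  (chi contDiff_chi hasCompactSupport_chi tendsto_integral_chi_mul tendsto_integral_partialP_chi_mul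
    integral_chi_mul_bathOp integral_chi_liouville_antisymm
    integrable_mul_mul_gibbsDensity integrable_sq_mul_gibbsDensity memLp_momentum memLp_kinetic memLp_hamiltonian
    integral_kinetic_mul_hamiltonian_mul_gibbsDensity gauss_ibp integral_sq_mul_gibbsDensity_eq
    partialQ_hamiltonian_rev integral_rev_mul_gibbsDensity rev)
open Summit.AtomisticToContinuum.FouriersLaw.Cruxes.SuperadditiveResistance.InsertionToolbox
  (pinnedChain_memLp_two_of_abs_le)

namespace Summit.AtomisticToContinuum.FouriersLaw.Cruxes.ConductanceLowerBound.ForecastSensitivity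

variable {ω₂ lam β γ T : ℝ}


/-! ## §1 Pairing the constraint with the energy -/

/-- **Pairing identity with `H` (Lebesgue form).**  For an admissible pair `(φ, χ)` of the `L`-chain (`L ≥ 2`),
`γ T (∫ p_0 ∂_{p_0}φ e^{−H/T} + ∫ p_{L−1} ∂_{p_{L−1}}φ e^{−H/T}) = T² ∫ e^{−H/T}`.
Proof: multiply the constraint by `χ_n H` and integrate; `∫ χ_n H X_Hχ ρ = −∫ χ_n χ X_H H ρ = 0`, the thermostat
term is the cut-off Dirichlet pairing with `∂_{p_b} H = p_b`, and `∫ (p_0² − T) H ρ = T² ∫ρ`; let `n → ∞`. [folklore] -/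
theorem certificate_pairing_hamiltonian_density (hω : 0 < ω₂) (hl : 0 ≤ lam) (hβ : 0 ≤ β) (hT : 0 < T)
    {L : ℕ} (hL : 2 ≤ L) {φ χ : PhaseSpace L → ℝ} (hφ : ContDiff ℝ 2 φ) (hχ : ContDiff ℝ 2 χ)
    (hφ0 : MemLp (partialP (⟨0, by omega⟩ : Fin L) φ) 2 ((pinnedChain ω₂ lam β γ).gibbsMeasure L T))
    (hφR : MemLp (partialP (⟨L - 1, by omega⟩ : Fin L) φ) 2 ((pinnedChain ω₂ lam β γ).gibbsMeasure L T))
    (hpair : ∀ x, γ * bathOp L (OscillatorChain.bathWeight L) T φ x +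
      liouvilleOp (pinnedChain ω₂ lam β γ) L χ x = -(kin L 0 x - T)) :
    γ * T * ((∫ x, x.2 ⟨0, by omega⟩ * partialP (⟨0, by omega⟩ : Fin L) φ x * (pinnedChain ω₂ lam β γ).gibbsDensity L T x) +
      ∫ x, x.2 ⟨L - 1, by omega⟩ * partialP (⟨L - 1, by omega⟩ : Fin L) φ x * (pinnedChain ω₂ lam β γ).gibbsDensity L T x) =
      T ^ 2 * ∫ x, (pinnedChain ω₂ lam β γ).gibbsDensity L T x := by
  have hL0 : 0 < L := by omega
  have hL1 : L - 1 < L := by omega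
  set B := OscillatorChain.bathWeight L with hB
  set i0 : Fin L := ⟨0, hL0⟩ with hi0
  set iR : Fin L := ⟨L - 1, hL1⟩ with hiR
  have hTne : T ≠ 0 := hT.ne'
  have hU := pinnedChain_contDiff_U ω₂ lam β γ (n := ∞)
  have hV := pinnedChain_contDiff_V ω₂ lam β γ (n := ∞)
  have hHs : ContDiff ℝ ∞ ((pinnedChain ω₂ lam β γ).hamiltonian L) := (pinnedChain ω₂ lam β γ).contDiff_hamiltonian hU hV L
  have hH2 : ContDiff ℝ 2 ((pinnedChain ω₂ lam β γ).hamiltonian L) := hHs.of_le (by norm_cast)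
  have hHc : Continuous ((pinnedChain ω₂ lam β γ).hamiltonian L) := hHs.continuous
  have hρc : Continuous ((pinnedChain ω₂ lam β γ).gibbsDensity L T) := pinnedChain_continuous_gibbsDensity ω₂ lam β γ L T
  have hφ1 : ContDiff ℝ 1 φ := hφ.of_le (by norm_cast)
  have hχ1 : ContDiff ℝ 1 χ := hχ.of_le (by norm_cast)
  have hdφc : ∀ i, Continuous (partialP i φ) := fun i => continuous_partialP hφ1 one_ne_zero i
  have hdH : ∀ i : Fin L, partialP i ((pinnedChain ω₂ lam β γ).hamiltonian L) = fun y => y.2 i :=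
    fun i => funext fun y => (pinnedChain ω₂ lam β γ).partialP_hamiltonian L y i
  have hXH : ∀ x, liouvilleOp (pinnedChain ω₂ lam β γ) L ((pinnedChain ω₂ lam β γ).hamiltonian L) x = 0 := fun x => liouvilleOp_hamiltonian (pinnedChain ω₂ lam β γ) L x
  have hχs : ∀ n, ContDiff ℝ ∞ (chi (pinnedChain ω₂ lam β γ) L n) := fun n => contDiff_chi hHs n
  have hχnc : ∀ n, Continuous (chi (pinnedChain ω₂ lam β γ) L n) := fun n => (hχs n).continuous
  have hχncs : ∀ n, HasCompactSupport (chi (pinnedChain ω₂ lam β γ) L n) := fun n => hasCompactSupport_chi hω hl hβ γ L n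
  have hdχnc : ∀ n i, Continuous (partialP i (chi (pinnedChain ω₂ lam β γ) L n)) := fun n i =>
    continuous_partialP ((hχs n).of_le (by norm_cast)) one_ne_zero i
  have hXχc : Continuous (liouvilleOp (pinnedChain ω₂ lam β γ) L χ) :=
    continuous_liouvilleOp (pinnedChain ω₂ lam β γ) (hU.of_le (by norm_cast)) (hV.of_le (by norm_cast)) hχ1
  have hSφc : Continuous (bathOp L B T φ) := continuous_bathOp hφ B T
  have hkc : Continuous (fun x : PhaseSpace L => kin L 0 x - T) := (continuous_kin 0).sub continuous_const
  -- the identity at cutoff level n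
  have hlevel : ∀ n : ℕ,
      γ * (-T * ∑ i, B i * ((∫ x, chi (pinnedChain ω₂ lam β γ) L n x * partialP i ((pinnedChain ω₂ lam β γ).hamiltonian L) x * partialP i φ x *
          (pinnedChain ω₂ lam β γ).gibbsDensity L T x) +
        ∫ x, (pinnedChain ω₂ lam β γ).hamiltonian L x * partialP i (chi (pinnedChain ω₂ lam β γ) L n) x * partialP i φ x * (pinnedChain ω₂ lam β γ).gibbsDensity L T x)) =
      -∫ x, chi (pinnedChain ω₂ lam β γ) L n x * (pinnedChain ω₂ lam β γ).hamiltonian L x * (kin L 0 x - T) * (pinnedChain ω₂ lam β γ).gibbsDensity L T x := by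
    intro n
    have hbath := integral_chi_mul_bathOp hω hl hβ γ L B hTne hH2 hφ n
    have hanti := integral_chi_liouville_antisymm hω hl hβ γ L hTne hH2 hχ n
    -- ∫ χ_n H X_Hχ ρ = 0
    have hX0 : ∫ x, chi (pinnedChain ω₂ lam β γ) L n x * (pinnedChain ω₂ lam β γ).hamiltonian L x * liouvilleOp (pinnedChain ω₂ lam β γ) L χ x *
        (pinnedChain ω₂ lam β γ).gibbsDensity L T x = 0 := by
      rw [← hanti]
      refine integral_congr_ae (ae_of_all _ fun x => ?_)
      dsimp only
      rw [hXH x]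
      ring
    -- integrate the constraint against χ_n H ρ
    have hI1 : Integrable fun x => chi (pinnedChain ω₂ lam β γ) L n x * (pinnedChain ω₂ lam β γ).hamiltonian L x * bathOp L B T φ x *
        (pinnedChain ω₂ lam β γ).gibbsDensity L T x :=
      Continuous.integrable_of_hasCompactSupport (by fun_prop) (((hχncs n).mul_right).mul_right.mul_right)
    have hI2 : Integrable fun x => chi (pinnedChain ω₂ lam β γ) L n x * (pinnedChain ω₂ lam β γ).hamiltonian L x * liouvilleOp (pinnedChain ω₂ lam β γ) L χ x *
        (pinnedChain ω₂ lam β γ).gibbsDensity L T x :=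
      Continuous.integrable_of_hasCompactSupport (by fun_prop) (((hχncs n).mul_right).mul_right.mul_right)
    have hsum : γ * (∫ x, chi (pinnedChain ω₂ lam β γ) L n x * (pinnedChain ω₂ lam β γ).hamiltonian L x * bathOp L B T φ x * (pinnedChain ω₂ lam β γ).gibbsDensity L T x) +
        ∫ x, chi (pinnedChain ω₂ lam β γ) L n x * (pinnedChain ω₂ lam β γ).hamiltonian L x * liouvilleOp (pinnedChain ω₂ lam β γ) L χ x * (pinnedChain ω₂ lam β γ).gibbsDensity L T x =
        -∫ x, chi (pinnedChain ω₂ lam β γ) L n x * (pinnedChain ω₂ lam β γ).hamiltonian L x * (kin L 0 x - T) * (pinnedChain ω₂ lam β γ).gibbsDensity L T x := by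
      rw [← integral_const_mul, ← integral_add (hI1.const_mul γ) hI2, ← integral_neg]
      refine integral_congr_ae (ae_of_all _ fun x => ?_)
      have := hpair x
      calc γ * (chi (pinnedChain ω₂ lam β γ) L n x * (pinnedChain ω₂ lam β γ).hamiltonian L x * bathOp L B T φ x * (pinnedChain ω₂ lam β γ).gibbsDensity L T x) +
          chi (pinnedChain ω₂ lam β γ) L n x * (pinnedChain ω₂ lam β γ).hamiltonian L x * liouvilleOp (pinnedChain ω₂ lam β γ) L χ x * (pinnedChain ω₂ lam β γ).gibbsDensity L T x
          = chi (pinnedChain ω₂ lam β γ) L n x * (pinnedChain ω₂ lam β γ).hamiltonian L x * (γ * bathOp L B T φ x + liouvilleOp (pinnedChain ω₂ lam β γ) L χ x) *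
            (pinnedChain ω₂ lam β γ).gibbsDensity L T x := by ring
        _ = chi (pinnedChain ω₂ lam β γ) L n x * (pinnedChain ω₂ lam β γ).hamiltonian L x * (-(kin L 0 x - T)) * (pinnedChain ω₂ lam β γ).gibbsDensity L T x := by rw [this]
        _ = -(chi (pinnedChain ω₂ lam β γ) L n x * (pinnedChain ω₂ lam β γ).hamiltonian L x * (kin L 0 x - T) * (pinnedChain ω₂ lam β γ).gibbsDensity L T x) := by ring
    rw [hX0, add_zero, hbath] at hsum
    exact hsum
  -- rewrite the weighted sums as the two contact terms
  have hlevel' : ∀ n : ℕ,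
      -(γ * T) * (((∫ x, chi (pinnedChain ω₂ lam β γ) L n x * partialP i0 ((pinnedChain ω₂ lam β γ).hamiltonian L) x * partialP i0 φ x *
          (pinnedChain ω₂ lam β γ).gibbsDensity L T x) +
          ∫ x, (pinnedChain ω₂ lam β γ).hamiltonian L x * partialP i0 (chi (pinnedChain ω₂ lam β γ) L n) x * partialP i0 φ x * (pinnedChain ω₂ lam β γ).gibbsDensity L T x) +
        ((∫ x, chi (pinnedChain ω₂ lam β γ) L n x * partialP iR ((pinnedChain ω₂ lam β γ).hamiltonian L) x * partialP iR φ x *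
          (pinnedChain ω₂ lam β γ).gibbsDensity L T x) +
          ∫ x, (pinnedChain ω₂ lam β γ).hamiltonian L x * partialP iR (chi (pinnedChain ω₂ lam β γ) L n) x * partialP iR φ x *
            (pinnedChain ω₂ lam β γ).gibbsDensity L T x)) =
      -∫ x, chi (pinnedChain ω₂ lam β γ) L n x * (pinnedChain ω₂ lam β γ).hamiltonian L x * (kin L 0 x - T) * (pinnedChain ω₂ lam β γ).gibbsDensity L T x := by
    intro n
    rw [← hlevel n, sum_bathWeight_mul' _ (b₀ := i0) (b₁ := iR) rfl rfl]
    ring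
  -- limits of the four Dirichlet-type terms
  have hp2 : ∀ i : Fin L, MemLp (fun x : PhaseSpace L => x.2 i) 2 ((pinnedChain ω₂ lam β γ).gibbsMeasure L T) :=
    fun i => memLp_momentum hω hl hβ L hT i
  have hH2m : MemLp ((pinnedChain ω₂ lam β γ).hamiltonian L) 2 ((pinnedChain ω₂ lam β γ).gibbsMeasure L T) := memLp_hamiltonian hω hl hβ L hT
  have hlimA : ∀ {i : Fin L}, MemLp (partialP i φ) 2 ((pinnedChain ω₂ lam β γ).gibbsMeasure L T) →
      Tendsto (fun n : ℕ => ∫ x, chi (pinnedChain ω₂ lam β γ) L n x * partialP i ((pinnedChain ω₂ lam β γ).hamiltonian L) x * partialP i φ x *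
        (pinnedChain ω₂ lam β γ).gibbsDensity L T x) atTop
        (𝓝 (∫ x, x.2 i * partialP i φ x * (pinnedChain ω₂ lam β γ).gibbsDensity L T x)) := by
    intro i hi
    have hF : Integrable fun x => x.2 i * partialP i φ x * (pinnedChain ω₂ lam β γ).gibbsDensity L T x :=
      integrable_mul_mul_gibbsDensity hω hl hβ γ L hT (hp2 i) hi
    refine (tendsto_integral_chi_mul hω.le hl hβ γ L T (F := fun x => x.2 i * partialP i φ x)
      (by fun_prop) hF).congr fun n => ?_
    refine integral_congr_ae (ae_of_all _ fun x => ?_)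
    simp only [hdH i]
    ring
  have hlimB : ∀ {i : Fin L}, MemLp (partialP i φ) 2 ((pinnedChain ω₂ lam β γ).gibbsMeasure L T) →
      Tendsto (fun n : ℕ => ∫ x, (pinnedChain ω₂ lam β γ).hamiltonian L x * partialP i (chi (pinnedChain ω₂ lam β γ) L n) x * partialP i φ x *
        (pinnedChain ω₂ lam β γ).gibbsDensity L T x) atTop (𝓝 0) := by
    intro i hi
    have hF : Integrable fun x => (pinnedChain ω₂ lam β γ).hamiltonian L x * partialP i φ x * (pinnedChain ω₂ lam β γ).gibbsDensity L T x :=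
      integrable_mul_mul_gibbsDensity hω hl hβ γ L hT hH2m hi
    refine (tendsto_integral_partialP_chi_mul hω hl hβ γ L T i
      (F := fun x => (pinnedChain ω₂ lam β γ).hamiltonian L x * partialP i φ x) (by fun_prop) hF).congr fun n => ?_
    exact integral_congr_ae (ae_of_all _ fun x => by ring)
  -- limit of the source term
  have hk2 : MemLp (fun x : PhaseSpace L => kin L 0 x - T) 2 ((pinnedChain ω₂ lam β γ).gibbsMeasure L T) :=
    (memLp_kinetic hω hl hβ L hT i0).ae_eq (ae_of_all _ fun x => by simp only [kin_eq_sq hL0]; rfl)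
  have hlimS : Tendsto (fun n : ℕ => ∫ x, chi (pinnedChain ω₂ lam β γ) L n x * (pinnedChain ω₂ lam β γ).hamiltonian L x * (kin L 0 x - T) *
      (pinnedChain ω₂ lam β γ).gibbsDensity L T x) atTop (𝓝 (T ^ 2 * ∫ x, (pinnedChain ω₂ lam β γ).gibbsDensity L T x)) := by
    have hF : Integrable fun x => (pinnedChain ω₂ lam β γ).hamiltonian L x * (kin L 0 x - T) * (pinnedChain ω₂ lam β γ).gibbsDensity L T x :=
      integrable_mul_mul_gibbsDensity hω hl hβ γ L hT hH2m hk2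
    have h := tendsto_integral_chi_mul hω.le hl hβ γ L T
      (F := fun x => (pinnedChain ω₂ lam β γ).hamiltonian L x * (kin L 0 x - T)) (by fun_prop) hF
    have heq : ∫ x, (pinnedChain ω₂ lam β γ).hamiltonian L x * (kin L 0 x - T) * (pinnedChain ω₂ lam β γ).gibbsDensity L T x =
        T ^ 2 * ∫ x, (pinnedChain ω₂ lam β γ).gibbsDensity L T x := by
      rw [← integral_kinetic_mul_hamiltonian_mul_gibbsDensity (γ := γ) hω hl hβ L hT i0]
      refine integral_congr_ae (ae_of_all _ fun x => ?_)
      simp only [kin_eq_sq hL0]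
      show (pinnedChain ω₂ lam β γ).hamiltonian L x * (x.2 ⟨0, hL0⟩ ^ 2 - T) * (pinnedChain ω₂ lam β γ).gibbsDensity L T x =
        (x.2 i0 ^ 2 - T) * (pinnedChain ω₂ lam β γ).hamiltonian L x * (pinnedChain ω₂ lam β γ).gibbsDensity L T x
      ring
    rw [heq] at h
    refine h.congr fun n => integral_congr_ae (ae_of_all _ fun x => by ring)
  have hLHS : Tendsto (fun n : ℕ =>
      -(γ * T) * (((∫ x, chi (pinnedChain ω₂ lam β γ) L n x * partialP i0 ((pinnedChain ω₂ lam β γ).hamiltonian L) x * partialP i0 φ x *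
          (pinnedChain ω₂ lam β γ).gibbsDensity L T x) +
          ∫ x, (pinnedChain ω₂ lam β γ).hamiltonian L x * partialP i0 (chi (pinnedChain ω₂ lam β γ) L n) x * partialP i0 φ x * (pinnedChain ω₂ lam β γ).gibbsDensity L T x) +
        ((∫ x, chi (pinnedChain ω₂ lam β γ) L n x * partialP iR ((pinnedChain ω₂ lam β γ).hamiltonian L) x * partialP iR φ x *
          (pinnedChain ω₂ lam β γ).gibbsDensity L T x) +
          ∫ x, (pinnedChain ω₂ lam β γ).hamiltonian L x * partialP iR (chi (pinnedChain ω₂ lam β γ) L n) x * partialP iR φ x *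
            (pinnedChain ω₂ lam β γ).gibbsDensity L T x))) atTop
      (𝓝 (-(γ * T) * (((∫ x, x.2 i0 * partialP i0 φ x * (pinnedChain ω₂ lam β γ).gibbsDensity L T x) + 0) +
        ((∫ x, x.2 iR * partialP iR φ x * (pinnedChain ω₂ lam β γ).gibbsDensity L T x) + 0)))) :=
    (((hlimA hφ0).add (hlimB hφ0)).add ((hlimA hφR).add (hlimB hφR))).const_mul _
  have heq := tendsto_nhds_unique (hLHS.congr hlevel') hlimS.neg
  simp only [add_zero] at heq
  linarith

/-- **Pairing identity with `H`.**  For `L ≥ 2` and every admissible pair `(φ, χ)` — `φ, χ ∈ C²`,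
`∂_{p_0}φ, ∂_{p_{L−1}}φ ∈ L²(μ_T)`, `γ S_B φ + X_H χ = −(p_0² − T)` pointwise —
`γ (⟨p_0, ∂_{p_0}φ⟩_{μ_T} + ⟨p_{L−1}, ∂_{p_{L−1}}φ⟩_{μ_T}) = T`: the `φ`-component of a certificate dissipates exactly
the injected power, split between the two contacts. [folklore] -/
theorem certificate_pairing_hamiltonian (hω : 0 < ω₂) (hl : 0 ≤ lam) (hβ : 0 ≤ β) (hT : 0 < T)
    {L : ℕ} (hL : 2 ≤ L) {φ χ : PhaseSpace L → ℝ} (hφ : ContDiff ℝ 2 φ) (hχ : ContDiff ℝ 2 χ)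
    (hφ0 : MemLp (partialP (⟨0, by omega⟩ : Fin L) φ) 2 ((pinnedChain ω₂ lam β γ).gibbsMeasure L T))
    (hφR : MemLp (partialP (⟨L - 1, by omega⟩ : Fin L) φ) 2 ((pinnedChain ω₂ lam β γ).gibbsMeasure L T))
    (hpair : ∀ x, γ * bathOp L (OscillatorChain.bathWeight L) T φ x +
      liouvilleOp (pinnedChain ω₂ lam β γ) L χ x = -(kin L 0 x - T)) :
    γ * ((∫ x, x.2 ⟨0, by omega⟩ * partialP (⟨0, by omega⟩ : Fin L) φ x ∂((pinnedChain ω₂ lam β γ).gibbsMeasure L T)) +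
      ∫ x, x.2 ⟨L - 1, by omega⟩ * partialP (⟨L - 1, by omega⟩ : Fin L) φ x ∂((pinnedChain ω₂ lam β γ).gibbsMeasure L T)) = T := by
  have h := certificate_pairing_hamiltonian_density hω hl hβ hT hL hφ hχ hφ0 hφR hpair
  have hZ : 0 < ∫ x, (pinnedChain ω₂ lam β γ).gibbsDensity L T x :=
    integral_exp_pos (pinnedChain_integrable_gibbsDensity hω hl hβ γ L hT)
  set A := ∫ x, x.2 ⟨0, by omega⟩ * partialP (⟨0, by omega⟩ : Fin L) φ x * (pinnedChain ω₂ lam β γ).gibbsDensity L T x with hA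
  set A' := ∫ x, x.2 ⟨L - 1, by omega⟩ * partialP (⟨L - 1, by omega⟩ : Fin L) φ x *
    (pinnedChain ω₂ lam β γ).gibbsDensity L T x with hA'
  set Z := ∫ x, (pinnedChain ω₂ lam β γ).gibbsDensity L T x with hZdef
  have hAB : γ * (A + A') = T * Z := mul_left_cancel₀ hT.ne' (by linear_combination h)
  rw [OscillatorChain.integral_gibbsMeasure, OscillatorChain.integral_gibbsMeasure]
  calc γ * (Z⁻¹ * A + Z⁻¹ * A') = Z⁻¹ * (γ * (A + A')) := by ring
    _ = Z⁻¹ * (T * Z) := by rw [hAB]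
    _ = T := by field_simp

/-- Registered helper sub-goal `helper_certificatePairingHamiltonian` of stub `stub_transmissionGradientFloor`
(= `certificate_pairing_hamiltonian` in closed form; line ForecastSensitivitySketch, crux stmt-AtomisticToContinuum-11749). [folklore] -/
theorem helper_certificatePairingHamiltonian : ∀ {ω₂ lam β γ T : ℝ}, 0 < ω₂ → 0 ≤ lam → 0 ≤ β → 0 < T → ∀ {L : ℕ} (hL : 2 ≤ L) {φ χ : PhaseSpace L → ℝ}, ContDiff ℝ 2 φ → ContDiff ℝ 2 χ → MemLp (partialP (⟨0, by omega⟩ : Fin L) φ) 2 ((pinnedChain ω₂ lam β γ).gibbsMeasure L T) → MemLp (partialP (⟨L - 1, by omega⟩ : Fin L) φ) 2 ((pinnedChain ω₂ lam β γ).gibbsMeasure L T) → (∀ x, γ * bathOp L (OscillatorChain.bathWeight L) T φ x + liouvilleOp (pinnedChain ω₂ lam β γ) L χ x = -(kin L 0 x - T)) → γ * ((∫ x, x.2 ⟨0, by omega⟩ * partialP (⟨0, by omega⟩ : Fin L) φ x ∂((pinnedChain ω₂ lam β γ).gibbsMeasure L T)) + ∫ x, x.2 ⟨L - 1, by omega⟩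 * partialP (⟨L - 1, by omega⟩ : Fin L) φ x ∂((pinnedChain ω₂ lam β γ).gibbsMeasure L T)) = T :=
  @certificate_pairing_hamiltonian

end Summit.AtomisticToContinuum.FouriersLaw.Cruxes.ConductanceLowerBound.ForecastSensitivity

end
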